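import Mathlib
import HarnessLib
import Literature.Computability.QuantumComplexity.PauliExpansion
import Summits.QuantumAdvantage.QuantumAdvantage.Theses.SymplecticPurity

/-!
# The S-box dictionary: Pauli spectrum of a graph vector (item stmt-QuantumAdvantage-9840)

For `f : 𝔽₂ⁿ → 𝔽₂ⁿ` with XOR-differential counts `≤ D` (`a ≠ 0`) and Walsh/linear correlations
`≤ Λ` (`β ≠ 0`), the unnormalised graph vector `g_f = Σ_x |x⟩|f x⟩` on `n + n` qubits satisfies
`|⟨g_f| S |g_f⟩| ≤ max D Λ` for every Pauli string `S ≠ I`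
(`Summit.QuantumAdvantage.QuantumAdvantage.Theses.SymplecticPurity.GraphStateSpectrum`).

Proof. A row of a tensor product `⊗ₖ Aₖ` of one-qubit matrices, each with at most one non-zero
entry per row (at the bit flipped by `t k`), has at most one non-zero entry, at `w ⊕ t`; hence
`⟨g_f| ⊗A |g_f⟩ = Σ_x [f (x ⊕ t₁) = f x ⊕ t₂] · (a product of entries of modulus ≤ 1)`, which is
bounded by the differential count (`t₁ ≠ 0`), vanishes (`t₁ = 0 ≠ t₂`), or — for a `Z`-type
string — equals the Walsh sum `Σ_x (−1)^{α·x ⊕ β·f(x)}` (`≤ Λ` if `β ≠ 0`, `= 0` if `β = 0 ≠ α`).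
-/

set_option linter.dupNamespace false -- D-0017: single-problem summit ⇒ `QuantumAdvantage.QuantumAdvantage` by design

namespace Summit.QuantumAdvantage.QuantumAdvantage.Theorems.SymplecticPurity

open Matrix Finset Literature.Computability.QuantumComplexity Literature.Computability.Cryptography

/-! ### One-qubit tables -/

/-- Every entry of a Pauli matrix has modulus at most `1`. [folklore] -/
theorem Pauli.norm_mat_le_one (Q : Pauli) (a b : Bool) : ‖Q.mat a b‖ ≤ 1 := by
  cases Q <;> cases a <;> cases b <;> simp

/-- Row support of a Pauli matrix: the only non-zero entry in row `a` sits in column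
`a ⊕ [Q ∈ {X, Y}]`. [folklore] -/
theorem Pauli.mat_eq_zero_of_ne (Q : Pauli) (a b : Bool)
    (h : b ≠ Bool.xor a (decide (Q = Pauli.X ∨ Q = Pauli.Y))) : Q.mat a b = 0 := by
  revert h
  cases Q <;> cases a <;> cases b <;> simp

/-- A letter that is neither `X` nor `Y` is `I` or `Z`. [folklore] -/
theorem Pauli.eq_I_or_eq_Z (Q : Pauli) (h : ¬ (Q = Pauli.X ∨ Q = Pauli.Y)) :
    Q = Pauli.I ∨ Q = Pauli.Z := by
  cases Q <;> simp_all

/-- Diagonal entries of `I` and `Z` as signs: `1`, resp. `(-1)^a`. [folklore] -/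
theorem Pauli.mat_diag_eq (Q : Pauli) (h : Q = Pauli.I ∨ Q = Pauli.Z) (a : Bool) :
    Q.mat a a = if (decide (Q = Pauli.Z) && a) then (-1 : ℂ) else 1 := by
  rcases h with rfl | rfl <;> cases a <;> simp

/-- `I` and `Z` are diagonal. [folklore] -/
theorem Pauli.mat_eq_zero_of_ne' (Q : Pauli) (h : Q = Pauli.I ∨ Q = Pauli.Z) (a b : Bool)
    (hab : b ≠ Bool.xor a false) : Q.mat a b = 0 := by
  rw [Bool.xor_false] at hab
  rcases h with rfl | rfl <;> cases a <;> cases b <;> simp_all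

/-- Three-term xor bookkeeping: `p ⊕ q = r ↔ r ⊕ p = q`. [folklore] -/
theorem Bool.xor_eq_iff_xor_eq (p q r : Bool) : (Bool.xor p q = r) ↔ (Bool.xor r p = q) := by
  cases p <;> cases q <;> cases r <;> decide

/-! ### Registers on `n + n` wires -/

variable {n : ℕ}

/-- Splitting a sum over `n + n`-bit strings into the two halves. [folklore] -/
theorem sum_qreg_add (F : QReg (n + n) → ℂ) :
    ∑ w, F w = ∑ x : QReg n, ∑ y : QReg n, F (Fin.append x y) := by
  rw [← Fintype.sum_prod_type']
  refine (Fintype.sum_bijective (fun p : QReg n × QReg n => Fin.append p.1 p.2) ⟨?_, ?_⟩ _ _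
    (fun _ => rfl)).symm
  · intro p q h
    have h1 : p.1 = q.1 := by
      funext i
      have := congrFun h (Fin.castAdd n i)
      simpa only [Fin.append_left] using this
    have h2 : p.2 = q.2 := by
      funext j
      have := congrFun h (Fin.natAdd n j)
      simpa only [Fin.append_right] using this
    exact Prod.ext h1 h2
  · intro w
    exact ⟨(fun i => w (Fin.castAdd n i), fun j => w (Fin.natAdd n j)), Fin.append_castAdd_natAdd⟩

/-- Summing an indicator of the graph `{(x, f x)}` against `F` picks out the graph points.
[folklore] -/
theorem sum_graph_indicator (f : QReg n → QReg n) (F : QReg (n + n) → ℂ) :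
    ∑ w : QReg (n + n), (if (fun j : Fin n => w (Fin.natAdd n j)) = f (fun i : Fin n => w (Fin.castAdd n i))
      then F w else 0) = ∑ x : QReg n, F (Fin.append x (f x)) := by
  rw [sum_qreg_add]
  refine Finset.sum_congr rfl fun x _ => ?_
  simp only [Fin.append_left, Fin.append_right]
  rw [Finset.sum_eq_single (f x)]
  · rw [if_pos rfl]
  · intro y _ hy
    rw [if_neg]
    exact fun h => hy h
  · intro h
    exact absurd (Finset.mem_univ _) h

/-- A tensor product of one-qubit matrices with one admissible column `a ⊕ t k` per row acts on a
vector by a single shifted, weighted evaluation. [folklore] -/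
theorem tensorAll_mulVec_of_flip {ι : Type*} [Fintype ι] [DecidableEq ι] (A : ι → Matrix Bool Bool ℂ)
    (t : ι → Bool) (hA : ∀ k a b, b ≠ Bool.xor a (t k) → A k a b = 0) (v : (ι → Bool) → ℂ)
    (w : ι → Bool) :
    (tensorAll A).mulVec v w =
      (∏ k, A k (w k) (Bool.xor (w k) (t k))) * v (fun k => Bool.xor (w k) (t k)) := by
  rw [Matrix.mulVec_apply_eq_sum (tensorAll A) v w]
  rw [Finset.sum_eq_single (fun k => Bool.xor (w k) (t k))]
  · rw [tensorAll_apply]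
  · intro w' _ hw'
    have : ¬ ∀ k, w' k = Bool.xor (w k) (t k) := fun h => hw' (funext h)
    obtain ⟨k, hk⟩ := not_forall.mp this
    rw [tensorAll_apply, Finset.prod_eq_zero (Finset.mem_univ k) (hA k _ _ hk), zero_mul]
  · intro h
    exact absurd (Finset.mem_univ _) h

/-- **Expectation of a monomial matrix in a graph vector.** For `g = Σ_x |x⟩|f x⟩` and `A = ⊗ₖ Aₖ`
whose row `a` of `Aₖ` is supported on the column `a ⊕ t k`, `t = (a₁, a₂)`:
`⟨g|A|g⟩ = Σ_x (∏ₖ Aₖ entries) · [f x ⊕ a₂ = f (x ⊕ a₁)]`. [folklore] -/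
theorem graph_expect_eq (f : QReg n → QReg n) (A : Fin (n + n) → Matrix Bool Bool ℂ)
    (a₁ a₂ : QReg n) (hA : ∀ k a b, b ≠ Bool.xor a (Fin.append a₁ a₂ k) → A k a b = 0)
    (g : QReg (n + n) → ℂ)
    (hg : g = fun w => if (fun j : Fin n => w (Fin.natAdd n j)) = f (fun i : Fin n => w (Fin.castAdd n i))
      then (1 : ℂ) else 0) :
    star g ⬝ᵥ (tensorAll A).mulVec g =
      ∑ x : QReg n, (∏ k, A k (Fin.append x (f x) k)
          (Bool.xor (Fin.append x (f x) k) (Fin.append a₁ a₂ k))) *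
        (if (fun j => Bool.xor (f x j) (a₂ j)) = f (fun i => Bool.xor (x i) (a₁ i)) then 1 else 0) := by
  have hs : ∀ (p : Prop) [Decidable p] (X : ℂ),
      star (if p then (1 : ℂ) else 0) * X = if p then X else 0 := by
    intro p _ X
    split_ifs <;> simp
  subst hg
  simp only [dotProduct, Pi.star_apply, tensorAll_mulVec_of_flip A _ hA, hs]
  rw [sum_graph_indicator]
  refine Finset.sum_congr rfl fun x _ => ?_
  simp only [Fin.append_left, Fin.append_right]

/-- **Norm bound.** If moreover every entry of every `Aₖ` has modulus `≤ 1`, then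
`|⟨g|A|g⟩| ≤ #{x : f (x ⊕ a₁) ⊕ f x = a₂}`. [folklore] -/
theorem graph_expect_norm_le (f : QReg n → QReg n) (A : Fin (n + n) → Matrix Bool Bool ℂ)
    (a₁ a₂ : QReg n) (hA : ∀ k a b, b ≠ Bool.xor a (Fin.append a₁ a₂ k) → A k a b = 0)
    (hA1 : ∀ k a b, ‖A k a b‖ ≤ 1) (g : QReg (n + n) → ℂ)
    (hg : g = fun w => if (fun j : Fin n => w (Fin.natAdd n j)) = f (fun i : Fin n => w (Fin.castAdd n i))
      then (1 : ℂ) else 0) :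
    ‖star g ⬝ᵥ (tensorAll A).mulVec g‖ ≤
      ((Finset.univ.filter fun x : QReg n =>
        (fun i => Bool.xor (f (fun j => Bool.xor (x j) (a₁ j)) i) (f x i)) = a₂).card : ℝ) := by
  rw [graph_expect_eq f A a₁ a₂ hA g hg]
  refine (norm_sum_le _ _).trans ?_
  rw [Finset.natCast_card_filter]
  refine Finset.sum_le_sum fun x _ => ?_
  rw [norm_mul]
  have key : ((fun j => Bool.xor (f x j) (a₂ j)) = f (fun i => Bool.xor (x i) (a₁ i))) ↔
      ((fun i => Bool.xor (f (fun j => Bool.xor (x j) (a₁ j)) i) (f x i)) = a₂) := by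
    simp only [funext_iff]
    exact forall_congr' fun j => Bool.xor_eq_iff_xor_eq _ _ _
  by_cases hc : (fun j => Bool.xor (f x j) (a₂ j)) = f (fun i => Bool.xor (x i) (a₁ i))
  · rw [if_pos hc, if_pos (key.mp hc), norm_one, mul_one, norm_prod]
    exact Finset.prod_le_one (fun _ _ => norm_nonneg _) (fun _ _ => hA1 _ _ _)
  · rw [if_neg hc, if_neg (fun h => hc (key.mpr h)), norm_zero, mul_zero]

/-- **`Z`-type strings give the Walsh sum.** For `S ∈ {I, Z}^{n+n}` with `Z`-pattern `(α, β)`,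
`⟨g|S|g⟩ = Σ_x (−1)^{α·x} (−1)^{β·f(x)}`. [folklore] -/
theorem graph_expect_zType (f : QReg n → QReg n) (S : Fin (n + n) → Pauli)
    (hS : ∀ k, S k = Pauli.I ∨ S k = Pauli.Z) (g : QReg (n + n) → ℂ)
    (hg : g = fun w => if (fun j : Fin n => w (Fin.natAdd n j)) = f (fun i : Fin n => w (Fin.castAdd n i))
      then (1 : ℂ) else 0) :
    star g ⬝ᵥ (pauliString S).mulVec g =
      ((∑ x : QReg n, (∏ i, if (decide (S (Fin.castAdd n i) = Pauli.Z) && x i) then (-1 : ℝ) else 1) *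
        (∏ j, if (decide (S (Fin.natAdd n j) = Pauli.Z) && f x j) then (-1 : ℝ) else 1) : ℝ) : ℂ) := by
  have hA : ∀ k a b, b ≠ Bool.xor a (Fin.append (fun _ : Fin n => false) (fun _ : Fin n => false) k) →
      (S k).mat a b = 0 := by
    intro k a b hab
    refine Pauli.mat_eq_zero_of_ne' _ (hS k) a b ?_
    induction k using Fin.addCases with
    | left i => simpa only [Fin.append_left] using hab
    | right j => simpa only [Fin.append_right] using hab
  rw [pauliString_eq, graph_expect_eq f _ _ _ hA g hg]
  push_cast
  refine Finset.sum_congr rfl fun x _ => ?_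
  rw [Fin.prod_univ_add]
  simp only [Fin.append_left, Fin.append_right, Bool.xor_false, if_true, mul_one]
  congr 1
  · refine Finset.prod_congr rfl fun i _ => ?_
    rw [Pauli.mat_diag_eq _ (hS _)]
    split_ifs <;> simp
  · refine Finset.prod_congr rfl fun j _ => ?_
    rw [Pauli.mat_diag_eq _ (hS _)]
    split_ifs <;> simp

/-- A non-trivial character of `𝔽₂ⁿ` sums to zero: `Σ_x (−1)^{α·x} = 0` for `α ≠ 0`. [folklore] -/
theorem walsh_sum_eq_zero (α : QReg n) (hα : α ≠ fun _ => false) :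
    ∑ x : QReg n, ∏ i, (if (α i && x i) then (-1 : ℝ) else 1) = 0 := by
  obtain ⟨i₀, hi₀⟩ : ∃ i, α i = true := by
    by_contra h
    apply hα
    funext i
    simpa using (not_exists.mp h) i
  rw [← Fintype.prod_sum (fun i b => if (α i && b) then (-1 : ℝ) else 1)]
  apply Finset.prod_eq_zero (Finset.mem_univ i₀)
  simp [hi₀]

/-! ### The dictionary -/

/-- **The S-box dictionary** (item stmt-QuantumAdvantage-9840, route SymplecticPurity): for
`f : 𝔽₂ⁿ → 𝔽₂ⁿ` with differential uniformity `≤ D` and linearity `≤ Λ`, the unnormalised graph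
vector `g_f = Σ_x |x⟩|f x⟩` satisfies `|⟨g_f|S|g_f⟩| ≤ max D Λ` for every Pauli string `S ≠ I`.
A string with `X`-part `(a, a')` pairs `|x, f x⟩` with `|x ⊕ a, f x ⊕ a'⟩` — non-zero only when
`f (x ⊕ a) = f x ⊕ a'` (`≤ D` unimodular terms if `a ≠ 0`, none if `a = 0 ≠ a'`); a `Z`-type
string gives the Walsh sum (`≤ Λ`, or `0` when `β = 0 ≠ α`). [folklore; cf. Nyberg EUROCRYPT'93,
Chabaud–Vaudenay EUROCRYPT'94 for the two S-box parameters] -/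
theorem GraphStateSpectrum_proof :
    Summit.QuantumAdvantage.QuantumAdvantage.Theses.SymplecticPurity.GraphStateSpectrum := by
  unfold Summit.QuantumAdvantage.QuantumAdvantage.Theses.SymplecticPurity.GraphStateSpectrum
  intro n f D Λ hD hΛ S hS
  -- the register is non-empty, so `0 ≤ D`
  have hn : 0 < n := by
    rcases Nat.eq_zero_or_pos n with rfl | h
    · exact absurd (funext fun k => Fin.elim0 (k.cast (Nat.zero_add 0))) hS
    · exact h
  have hD0 : 0 ≤ D := by
    have hne : (fun _ : Fin n => true) ≠ fun _ => false := by
      intro h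
      have := congrFun h ⟨0, hn⟩
      simp at this
    exact le_trans (Nat.cast_nonneg _) (hD _ hne (fun _ => false))
  -- the X-part `(a₁, a₂)` of `S`
  obtain ⟨a₁, ha₁⟩ : ∃ a₁ : QReg n, ∀ i,
      a₁ i = decide (S (Fin.castAdd n i) = Pauli.X ∨ S (Fin.castAdd n i) = Pauli.Y) :=
    ⟨_, fun _ => rfl⟩
  obtain ⟨a₂, ha₂⟩ : ∃ a₂ : QReg n, ∀ j,
      a₂ j = decide (S (Fin.natAdd n j) = Pauli.X ∨ S (Fin.natAdd n j) = Pauli.Y) :=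
    ⟨_, fun _ => rfl⟩
  have hA : ∀ k a b, b ≠ Bool.xor a (Fin.append a₁ a₂ k) → (S k).mat a b = 0 := by
    intro k
    induction k using Fin.addCases with
    | left i =>
      intro a b h
      rw [Fin.append_left, ha₁ i] at h
      exact Pauli.mat_eq_zero_of_ne _ _ _ h
    | right j =>
      intro a b h
      rw [Fin.append_right, ha₂ j] at h
      exact Pauli.mat_eq_zero_of_ne _ _ _ h
  have bound := graph_expect_norm_le f (fun k => (S k).mat) a₁ a₂ hA
    (fun k a b => Pauli.norm_mat_le_one _ _ _) _ rfl
  rw [← pauliString_eq] at bound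
  by_cases h₁ : a₁ = fun _ => false
  · by_cases h₂ : a₂ = fun _ => false
    · -- `Z`-type string: the Walsh sum
      have hIZ : ∀ k, S k = Pauli.I ∨ S k = Pauli.Z := by
        intro k
        induction k using Fin.addCases with
        | left i =>
          refine Pauli.eq_I_or_eq_Z _ (of_decide_eq_false ?_)
          rw [← ha₁ i, h₁]
        | right j =>
          refine Pauli.eq_I_or_eq_Z _ (of_decide_eq_false ?_)
          rw [← ha₂ j, h₂]
      rw [graph_expect_zType f S hIZ _ rfl, Complex.norm_real, Real.norm_eq_abs]
      by_cases hβ : (fun j => decide (S (Fin.natAdd n j) = Pauli.Z)) = fun _ => false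
      · have hβj : ∀ j, decide (S (Fin.natAdd n j) = Pauli.Z) = false := fun j => congrFun hβ j
        have hα : (fun i => decide (S (Fin.castAdd n i) = Pauli.Z)) ≠ fun _ => false := by
          intro hα
          have hαi : ∀ i, decide (S (Fin.castAdd n i) = Pauli.Z) = false := fun i => congrFun hα i
          apply hS
          funext k
          induction k using Fin.addCases with
          | left i =>
            rcases hIZ (Fin.castAdd n i) with h | h
            · exact h
            · exact absurd h (of_decide_eq_false (hαi i))
          | right j =>
            rcases hIZ (Fin.natAdd n j) with h | h
            · exact h
            · exact absurd h (of_decide_eq_false (hβj j))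
        simp only [hβj, Bool.false_and, Bool.false_eq_true, if_false, Finset.prod_const_one,
          mul_one]
        rw [walsh_sum_eq_zero _ hα, abs_zero]
        exact le_max_of_le_left hD0
      · exact (hΛ _ hβ _).trans (le_max_right _ _)
    · -- `a₁ = 0 ≠ a₂`: no term survives
      have hempty : (Finset.univ.filter fun x : QReg n =>
          (fun i => Bool.xor (f (fun j => Bool.xor (x j) (a₁ j)) i) (f x i)) = a₂) = ∅ := by
        refine Finset.filter_eq_empty_iff.mpr fun x _ hx => h₂ ?_
        rw [← hx]
        funext i
        simp [h₁]
      rw [hempty, Finset.card_empty, Nat.cast_zero] at bound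
      exact bound.trans (hD0.trans (le_max_left _ _))
  · exact bound.trans ((hD a₁ h₁ a₂).trans (le_max_left _ _))

end Summit.QuantumAdvantage.QuantumAdvantage.Theorems.SymplecticPurity
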